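import Mathlib
import Literature.Computability.Complexity.GraphCanonization
import Literature.Computability.Complexity.GraphCanonizationProgram

/-!
# Stub `stub_canonicalFormFTIME` (S1a) of line `canonical-form-completeness` for crux
`SymmetryBudget.WindowBarrier` (item stmt-PneNP-2145, route route-PneNP-SymmetryBudget)

The registered stub is the tree's named fact `Literature.Computability.Complexity.babaiLuks1983_canonicalForm`
(canonical forms of vertex-coloured graphs in time `2^{O(√N)}`, Babai–Luks 1983 / Corneil–Goldberg 1984)
with `colGraphCode` and `ColIso` unfolded; it is now DISCHARGED by
`Literature.Computability.Complexity.babaiLuks1983_canonicalForm_holds` (`GraphCanonizationProgram.lean`: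
a Corneil–Goldberg-type canoniser — colour refinement, individualization of a least big cell, sections
along the components of the switched graph — formalised as a polynomial-time string program on the
padded code, `2^{14k+1}` recursion nodes).

## References

* L. Babai, E. M. Luks, *Canonical labeling of graphs*, STOC 1983, Abstract and §4. [BabaiLuks1983]
* D. G. Corneil, M. K. Goldberg, J. Algorithms 5 (1984) 345–362. [CorneilGoldberg1984]
-/

set_option linter.dupNamespace false -- `Summit.PneNP.PneNP.…`: summit = sub-problem name (D-0017 single-conjunct layout)

namespace Summit.PneNP.PneNP.Theorems

open Literature.Computability.Complexity Computability

/-- **S1a, discharged**: canonical forms of vertex-coloured graphs computable in time `2^{O(√N)}` —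
the registered stub `stub_canonicalFormFTIME` of line `canonical-form-completeness`, literally the
named fact `babaiLuks1983_canonicalForm` unfolded, proved by `babaiLuks1983_canonicalForm_holds`.
[cite: BabaiLuks1983, Abstract and §4] -/
theorem stub_canonicalFormFTIME :
    ∃ c : ℕ, ∃ can ∈ FTIME (fun N => 2 ^ (c * Nat.sqrt N)),
      (∀ (k : ℕ) (G : SimpleGraph (Fin k)) (col : Fin k → ℕ),
          ∃ (G' : SimpleGraph (Fin k)) (col' : Fin k → ℕ),
            can (boolPair (encodingGraph.encode ⟨k, G⟩)
                  ((encodingFinVec Computability.encodingNatBool k).encode col)) =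
                boolPair (encodingGraph.encode ⟨k, G'⟩)
                  ((encodingFinVec Computability.encodingNatBool k).encode col') ∧
              ∃ σ : G ≃g G', ∀ v : Fin k, col' (σ v) = col v) ∧
      ∀ (k : ℕ) (G₁ : SimpleGraph (Fin k)) (c₁ : Fin k → ℕ) (G₂ : SimpleGraph (Fin k))
        (c₂ : Fin k → ℕ), (∃ σ : G₁ ≃g G₂, ∀ v : Fin k, c₂ (σ v) = c₁ v) →
          can (boolPair (encodingGraph.encode ⟨k, G₁⟩)
                ((encodingFinVec Computability.encodingNatBool k).encode c₁)) =
            can (boolPair (encodingGraph.encode ⟨k, G₂⟩)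
                ((encodingFinVec Computability.encodingNatBool k).encode c₂)) :=
  babaiLuks1983_canonicalForm_holds

end Summit.PneNP.PneNP.Theorems
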